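/-
Copyright (c) 2026 the pub-hodgecm-mathlib formalisation cell (harness21).  Prover seat hodgecm-mathlib-K2E2-p12 (g3): Track B «K2-LIT»,
#184♮ = hLiu418 = stmt-HodgeConjecture-24832; organ #33b (D0) «THE LOCAL SIEGEL CHARACTER IS LOCALLY CONSTANT» of the tier-1 socket module
`Cruxes/HLiu418/Lines/K2_Liu_CurveThetaSigs_U5d_ZetaS.lean` (hidden input of (D) found in K2E2-p12 (g3)'s census 2026-09-04T05:45Z; LEAD F0P6-plan (g11)
RULING «M-155n» (3): owner (D) = K2E2-p12); 2026-09-04.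
-/
import Summits.HodgeConjecture.HodgeConjecture.Theorems.K2LiuSiegelWeilSectionContinuous       -- ★ `continuous_siegelDeltaCharacter_subtype`
import Summits.HodgeConjecture.HodgeConjecture.Theorems.K2LiuSiegelDoubledParabolicReduction    -- ★ `isClosed_siegelDelta`
import Summits.HodgeConjecture.HodgeConjecture.Theorems.K2LiuIwasawaDatumStdSmooth            -- ★ `exists_openSubgroup_forall_eq_one`, `totallyDisconnectedSpace_finAdelic`
import Summits.HodgeConjecture.HodgeConjecture.Theorems.K2LiuIwasawaDatumAdapted              -- ★ `exists_subgroup_adapted`, `isCompact_adapted`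
import Summits.HodgeConjecture.HodgeConjecture.Theorems.K2LiuStdFamilyFactorisablePrelims    -- ★ `archPart_locToAdelic`, `evalPlace_finPart_locToAdelic_self/_of_ne`, `eq_of_archPart_eq_of_finPart_eq`
import HarnessLib

/-!
# Crux `HLiu418`, Track B road `K2_Liu`, unit U5d «`Z_S`», organ #33b (D0):
# the local Siegel character `δ_v = χ_v(det_Δ ·)|det_Δ ·|_v^{s+n/2}` is locally constant on `P_Δ(L⁺_v)`

Cell `hodgecm-mathlib`, crux item hLiu418 = `stmt-HodgeConjecture-24832`, route of record `HCCMUnconditional`; squad K2 ∕ K2Liu.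

`T := δ_{χ,s}` is a continuous (★ `continuous_siegelDeltaCharacter_subtype`) multiplicative (★ `siegelDeltaCharacter_mul`) map on the COMPACT, Hausdorff,
TOTALLY DISCONNECTED group `G₁ := P_Δ(𝔸) ⊓ K⁰` (`K⁰ = {k | k_∞ = 1, k_v ∈ K_{H,v} ∀ v}` = the adapted level of `{1}` with `S = ∅`, ★ `exists_subgroup_adapted` ∕
★ `isCompact_adapted`; ★ `isClosed_siegelDelta`; totally disconnected because `finPart` embeds it into `H(𝔸_f)`, ★ `totallyDisconnectedSpace_finAdelic`),
so by the no-small-subgroups lemma ★ `exists_openSubgroup_forall_eq_one` it is trivial on an OPEN subgroup of `G₁`; pulled back along the continuous place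
inclusion `ι_v = locToAdelic v` this is an open neighbourhood of `1` in `H(L⁺_v)` on whose Siegel elements `siegelCharLoc v χ s = 1`
(`exists_isOpen_siegelCharLoc_eq_one`), whence `siegelCharLoc v χ s` is LOCALLY CONSTANT on the subgroup `P_Δ(L⁺_v)` (`isLocallyConstant_siegelCharLoc_subtype`,
by multiplicativity ★ `siegelCharLoc_mul`).  Input of (D): the recipe `φ_v(p·ι(x,1)) := δ_v(p)·g_v(x)` on the doubling main orbit is locally constant only
because `δ_v` is. [cite: Tan1999, §1] [cite: BorelJacquet1979, §1.1] [cite: MontgomeryZippin1955, §2.11] [cite: HarrisKudlaSweet1996, §1 (1.15)]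

HONEST LABEL: HC_CM is proved only modulo the 7 printed citations (2 remaining named inputs: hLiu418 = stmt-HodgeConjecture-24832,
h413 = stmt-HodgeConjecture-24833) until rung 0 closes; this file is a helper (`--supports stmt-HodgeConjecture-24832`) and closes no socket by itself.
-/

set_option linter.dupNamespace false

noncomputable section

open scoped RestrictedProduct Topology
open Filter NumberField IsDedekindDomain

namespace Summit.HodgeConjecture.HodgeConjecture.Cruxes.HLiu418.K2LiuSiegelCharLocLocallyConstant

open Literature.NumberTheory.Automorphic Literature.NumberTheory.Automorphic.UnitaryGroup Literature.NumberTheory.GaloisRepresentations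
open Literature.NumberTheory.GelbartRogawski1991 Literature.NumberTheory.GelbartRogawski1991.GRConstruction
open Literature.NumberTheory.K2Lit.SiegelDoubled
open Summit.HodgeConjecture.HodgeConjecture.Cruxes.HLiu418.K2LiuStdFamilyFactorisable
open Summit.HodgeConjecture.HodgeConjecture.Cruxes.HLiu418.K2LiuSiegelWeilSectionContinuous (continuous_siegelDeltaCharacter_subtype)
open Summit.HodgeConjecture.HodgeConjecture.Cruxes.HLiu418.K2LiuSiegelDoubledParabolicReduction (isClosed_siegelDelta)
open Summit.HodgeConjecture.HodgeConjecture.Cruxes.HLiu418.K2LiuIwasawaDatumStdSmooth (exists_openSubgroup_forall_eq_one)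
open Summit.HodgeConjecture.HodgeConjecture.Cruxes.HLiu418.K2LiuIwasawaDatumAdapted (exists_subgroup_adapted isCompact_adapted)

variable (L : Type) [Field L] [NumberField L] [IsCMField L]
variable {N M n : ℕ} (e : Fin N × Fin M ≃ Fin n)
  (dV : Fin N → L) (hdV : ∀ i, IsCMField.complexConj L (dV i) = dV i)
  (dW : Fin M → L) (hdW : ∀ i, IsCMField.complexConj L (dW i) = dW i)
  (v : HeightOneSpectrum (𝓞 (Fp L))) (χ : HeckeCharacter L) (s : ℂ)

set_option maxHeartbeats 1600000 in -- measured: > 800 000 (three `inferInstanceAs` Hausdorff instances + the subgroup-coerced carriers of the telescope)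
/-- **`δ_{χ,s}` is trivial near `1` on every compact subgroup of `P_Δ(𝔸)` with trivial archimedean part**: such a subgroup is a compact Hausdorff
totally disconnected group (`finPart` is injective on it, into the totally disconnected `H(𝔸_f)`, ★ `totallyDisconnectedSpace_finAdelic`), on which the
continuous multiplicative `δ_{χ,s}` (★ `continuous_siegelDeltaCharacter_subtype`, ★ `siegelDeltaCharacter_mul`) has open kernel (★ `exists_openSubgroup_forall_eq_one`).
[cite: MontgomeryZippin1955, §2.11] [cite: BorelJacquet1979, §1.1] [cite: Tan1999, §1] -/
theorem exists_isOpen_siegelDeltaCharacter_eq_one_of_isCompact (G₁ : Subgroup (HA L e dV hdV dW hdW)) (hG₁c : IsCompact (G₁ : Set (HA L e dV hdV dW hdW)))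
    (hΔ : ∀ k ∈ G₁, IsSiegelDelta L e dV hdV dW hdW k) (h1 : ∀ k ∈ G₁, archPart (Fp L) L (IsCMField.complexConj L) (n + n) (hermD L e dV hdV dW hdW) k = 1) :
    ∃ O' : Set (HA L e dV hdV dW hdW), IsOpen O' ∧ (1 : HA L e dV hdV dW hdW) ∈ O' ∧ ∀ k ∈ O', k ∈ G₁ → siegelDeltaCharacter L e dV hdV dW hdW χ s k = 1 := by
  classical
  haveI : T2Space (InfiniteAdeleRing L) := inferInstanceAs (T2Space ((v : InfinitePlace L) → v.Completion))
  haveI : T2Space (FiniteAdeleRing (𝓞 L) L) :=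
    inferInstanceAs (T2Space (RestrictedProduct (fun v : HeightOneSpectrum (𝓞 L) => v.adicCompletion L)
      (fun v => (v.adicCompletionIntegers L : Set (v.adicCompletion L))) Filter.cofinite))
  haveI : T2Space (AdeleRing (𝓞 L) L) := inferInstanceAs (T2Space (InfiniteAdeleRing L × FiniteAdeleRing (𝓞 L) L))
  haveI : TotallyDisconnectedSpace (finAdelic (Fp L) L (IsCMField.complexConj L) (n + n) (hermD L e dV hdV dW hdW)) := totallyDisconnectedSpace_finAdelic (Fp L) L
      (IsCMField.complexConj L) (n + n) (hermD L e dV hdV dW hdW)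
  haveI hcs : CompactSpace ↥G₁ := isCompact_iff_compactSpace.1 hG₁c
  haveI : TotallyDisconnectedSpace ↥G₁ := by
    have hinj : Function.Injective fun k : ↥G₁ => finPart (Fp L) L (IsCMField.complexConj L) (n + n) (hermD L e dV hdV dW hdW) (k : HA L e dV hdV dW hdW) := fun k k' h =>
      Subtype.ext (eq_of_archPart_eq_of_finPart_eq L e dV hdV dW hdW _ _ (by rw [h1 _ k.2, h1 _ k'.2]) h)
    have hcont : Continuous fun k : ↥G₁ => finPart (Fp L) L (IsCMField.complexConj L) (n + n) (hermD L e dV hdV dW hdW) (k : HA L e dV hdV dW hdW) :=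
      (continuous_finPart (Fp L) L (IsCMField.complexConj L) (n + n) (hermD L e dV hdV dW hdW) : Continuous fun k : HA L e dV hdV dW hdW => finPart (Fp L) L (IsCMField.complexConj L)
          (n + n) (hermD L e dV hdV dW hdW) k).comp continuous_subtype_val
    refine ⟨isTotallyDisconnected_of_image hcont.continuousOn hinj ?_⟩
    exact isTotallyDisconnected_of_totallyDisconnectedSpace _
  obtain ⟨H₀, hH₀⟩ := @exists_openSubgroup_forall_eq_one ↥G₁ _ _ _ hcs _ _ ℂ _ _ _ (fun k : ↥G₁ => siegelDeltaCharacter L e dV hdV dW hdW χ s (k : HA L e dV hdV dW hdW))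
    (by rw [OneMemClass.coe_one, siegelDeltaCharacter_one])
    (fun k k' => by rw [Subgroup.coe_mul, siegelDeltaCharacter_mul L e dV hdV dW hdW χ s (hΔ _ k.2) (hΔ _ k'.2)])
    (((continuous_siegelDeltaCharacter_subtype L e dV hdV dW hdW χ s).comp
      (continuous_subtype_val.subtype_mk fun k : ↥G₁ => (mem_siegelDelta_iff L e dV hdV dW hdW _).2 (hΔ _ k.2))).congr fun _ => rfl)
  obtain ⟨O', hO'open, hO'eq⟩ := isOpen_induced_iff.1 H₀.isOpen
  refine ⟨O', hO'open, ?_, fun k hk hkG => ?_⟩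
  · have h : (1 : ↥G₁) ∈ Subtype.val ⁻¹' O' := by rw [hO'eq]; exact H₀.one_mem
    exact h
  · have h : (⟨k, hkG⟩ : ↥G₁) ∈ Subtype.val ⁻¹' O' := hk
    rw [hO'eq] at h
    exact hH₀ ⟨k, hkG⟩ (SetLike.mem_coe.1 h)

set_option maxHeartbeats 800000 in -- the doubled unitary datum's binder telescope + subgroup-coerced carriers
/-- **an open neighbourhood of `1` in `H(L⁺_v)` on whose Siegel elements the local Siegel character is `1`**: ★ the previous lemma on the compact group
`P_Δ(𝔸) ⊓ K⁰` (`K⁰` = the adapted level of `{1}` with `S = ∅`, ★ `exists_subgroup_adapted` ∕ ★ `isCompact_adapted`; ★ `isClosed_siegelDelta`), pulled back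
along `ι_v` and cut by the open `K_{H,v}`. [cite: Tan1999, §1] [cite: HarrisKudlaSweet1996, §1 (1.15)] [cite: BorelJacquet1979, §1.1] [cite: MontgomeryZippin1955, §2.11] -/
theorem exists_isOpen_siegelCharLoc_eq_one :
    ∃ O : Set (localPi L (IsCMField.complexConj L) (n + n) (hermD L e dV hdV dW hdW) v), IsOpen O ∧ (1 : localPi L (IsCMField.complexConj L) (n + n)
        (hermD L e dV hdV dW hdW) v) ∈ O ∧ ∀ u ∈ O, u ∈ siegelDeltaLoc L e dV hdV dW hdW v → siegelCharLoc L e dV hdV dW hdW v χ s u = 1 := by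
  classical
  obtain ⟨K, hK⟩ := exists_subgroup_adapted L e dV hdV dW hdW (⊥ : Subgroup (HA L e dV hdV dW hdW)) (∅ : Finset (HeightOneSpectrum (𝓞 (Fp L))))
  have hKc : IsCompact (K : Set (HA L e dV hdV dW hdW)) :=
    isCompact_adapted L e dV hdV dW hdW (by rw [Subgroup.coe_bot]; exact isCompact_singleton) (∅ : Finset (HeightOneSpectrum (𝓞 (Fp L)))) hK
  have hG₁c : IsCompact ((siegelDelta L e dV hdV dW hdW ⊓ K : Subgroup (HA L e dV hdV dW hdW)) : Set (HA L e dV hdV dW hdW)) := by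
    rw [Subgroup.coe_inf]; exact hKc.inter_left (isClosed_siegelDelta L e dV hdV dW hdW)
  have hΔK : ∀ k ∈ siegelDelta L e dV hdV dW hdW ⊓ K, IsSiegelDelta L e dV hdV dW hdW k := fun k hk => (Subgroup.mem_inf.1 hk).1
  have h1K : ∀ k ∈ siegelDelta L e dV hdV dW hdW ⊓ K, archPart (Fp L) L (IsCMField.complexConj L) (n + n) (hermD L e dV hdV dW hdW) k = 1 := fun k hk => by
    obtain ⟨⟨k₉, hk₉, h1, -⟩, -⟩ := (hK _).1 (Subgroup.mem_inf.1 hk).2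
    rw [← h1, Subgroup.mem_bot.1 hk₉, archPart_one']
  obtain ⟨O', hO'open, h1, hO'⟩ := exists_isOpen_siegelDeltaCharacter_eq_one_of_isCompact L e dV hdV dW hdW χ s _ hG₁c hΔK h1K
  refine ⟨locToAdelic L e dV hdV dW hdW v ⁻¹' O' ∩ (localInt L (IsCMField.complexConj L) (n + n) (hermD L e dV hdV dW hdW) v : Set (localPi L (IsCMField.complexConj L) (n + n)
      (hermD L e dV hdV dW hdW) v)),
    (hO'open.preimage (continuous_inclPlaceAdelic (Fp L) L (IsCMField.complexConj L) (n + n) (hermD L e dV hdV dW hdW) v)).inter (isOpen_localInt L (IsCMField.complexConj L) (n + n)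
        (hermD L e dV hdV dW hdW) v),
    ⟨by rw [Set.mem_preimage, map_one]; exact h1, one_mem _⟩, fun u hu hΔ => ?_⟩
  refine hO' _ hu.1 (Subgroup.mem_inf.2 ⟨hΔ, (hK _).2 ⟨⟨1, (⊥ : Subgroup (HA L e dV hdV dW hdW)).one_mem, ?_, fun w => absurd w.2 (Finset.notMem_empty _)⟩, fun w _ => ?_⟩⟩)
  · rw [archPart_one', archPart_locToAdelic]
  · by_cases hw : w = v
    · subst hw; rw [evalPlace_finPart_locToAdelic_self]; exact hu.2
    · rw [evalPlace_finPart_locToAdelic_of_ne L e dV hdV dW hdW hw]; exact one_mem _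

/-- **THE LOCAL SIEGEL CHARACTER IS LOCALLY CONSTANT ON `P_Δ(L⁺_v)`** (#33b (D0)): `p ↦ siegelCharLoc v χ s p` is locally constant on the subgroup
`siegelDeltaLoc v` (near `p₀` it equals `δ_v(p₀)·δ_v(p₀⁻¹p) = δ_v(p₀)`, ★ `siegelCharLoc_mul`). [cite: Tan1999, §1] [cite: HarrisKudlaSweet1996, §1 (1.15)] -/
theorem isLocallyConstant_siegelCharLoc_subtype :
    IsLocallyConstant (fun p : ↥(siegelDeltaLoc L e dV hdV dW hdW v) => siegelCharLoc L e dV hdV dW hdW v χ s (p : localPi L (IsCMField.complexConj L) (n + n)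
        (hermD L e dV hdV dW hdW) v)) := by
  obtain ⟨O, hO, h1O, hO1⟩ := exists_isOpen_siegelCharLoc_eq_one L e dV hdV dW hdW v χ s
  refine (IsLocallyConstant.iff_eventually_eq _).2 fun p₀ => ?_
  have hopen : IsOpen ((fun p : ↥(siegelDeltaLoc L e dV hdV dW hdW v) => ((p₀ : localPi L (IsCMField.complexConj L) (n + n) (hermD L e dV hdV dW hdW) v)⁻¹ * (p : localPi L
      (IsCMField.complexConj L) (n + n) (hermD L e dV hdV dW hdW) v))) ⁻¹' O) :=
    hO.preimage (continuous_const.mul continuous_subtype_val)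
  have hmem : p₀ ∈ (fun p : ↥(siegelDeltaLoc L e dV hdV dW hdW v) => ((p₀ : localPi L (IsCMField.complexConj L) (n + n) (hermD L e dV hdV dW hdW) v)⁻¹ * (p : localPi L
      (IsCMField.complexConj L) (n + n) (hermD L e dV hdV dW hdW) v))) ⁻¹' O := by
    rw [Set.mem_preimage, inv_mul_cancel]; exact h1O
  filter_upwards [hopen.mem_nhds hmem] with p hp
  have hq : siegelCharLoc L e dV hdV dW hdW v χ s ((p₀ : localPi L (IsCMField.complexConj L) (n + n) (hermD L e dV hdV dW hdW) v)⁻¹ * (p : localPi L (IsCMField.complexConj L) (n + n)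
      (hermD L e dV hdV dW hdW) v)) = 1 :=
    hO1 _ hp (mul_mem (inv_mem p₀.2) p.2)
  have hfac : (p : localPi L (IsCMField.complexConj L) (n + n) (hermD L e dV hdV dW hdW) v) = (p₀ : localPi L (IsCMField.complexConj L) (n + n) (hermD L e dV hdV dW hdW) v) *
      ((p₀ : localPi L (IsCMField.complexConj L) (n + n) (hermD L e dV hdV dW hdW) v)⁻¹ * (p : localPi L (IsCMField.complexConj L) (n + n)
      (hermD L e dV hdV dW hdW) v)) := by rw [mul_inv_cancel_left]
  calc siegelCharLoc L e dV hdV dW hdW v χ s (p : localPi L (IsCMField.complexConj L) (n + n) (hermD L e dV hdV dW hdW) v)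
      = siegelCharLoc L e dV hdV dW hdW v χ s ((p₀ : localPi L (IsCMField.complexConj L) (n + n) (hermD L e dV hdV dW hdW) v) * ((p₀ : localPi L (IsCMField.complexConj L) (n + n)
          (hermD L e dV hdV dW hdW) v)⁻¹ * (p : localPi L (IsCMField.complexConj L) (n + n) (hermD L e dV hdV dW hdW) v))) := by rw [← hfac]
    _ = siegelCharLoc L e dV hdV dW hdW v χ s (p₀ : localPi L (IsCMField.complexConj L) (n + n) (hermD L e dV hdV dW hdW) v) * siegelCharLoc L e dV hdV dW hdW v χ s ((p₀ : localPi L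
        (IsCMField.complexConj L) (n + n) (hermD L e dV hdV dW hdW) v)⁻¹ * (p : localPi L (IsCMField.complexConj L) (n + n) (hermD L e dV hdV dW hdW) v)) :=
          siegelCharLoc_mul L e dV hdV dW hdW v χ s p₀.2 (mul_mem (inv_mem p₀.2) p.2)
    _ = siegelCharLoc L e dV hdV dW hdW v χ s (p₀ : localPi L (IsCMField.complexConj L) (n + n) (hermD L e dV hdV dW hdW) v) := by rw [hq, mul_one]

/-- the `IsLocallyConstant`-free spelling used by (D): every `p₀ ∈ P_Δ(L⁺_v)` has an open neighbourhood in `H(L⁺_v)` on whose Siegel elements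
`siegelCharLoc v χ s` is constant. [cite: Tan1999, §1] [cite: HarrisKudlaSweet1996, §1 (1.15)] -/
theorem exists_isOpen_siegelCharLoc_eq (p₀ : localPi L (IsCMField.complexConj L) (n + n) (hermD L e dV hdV dW hdW) v) (hp₀ : p₀ ∈ siegelDeltaLoc L e dV hdV dW hdW v) :
    ∃ O : Set (localPi L (IsCMField.complexConj L) (n + n)
        (hermD L e dV hdV dW hdW) v), IsOpen O ∧ p₀ ∈ O ∧ ∀ p ∈ O, p ∈ siegelDeltaLoc L e dV hdV dW hdW v → siegelCharLoc L e dV hdV dW hdW v χ s p = siegelCharLoc L e dV hdV dW hdW v χ s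
        p₀ := by
  obtain ⟨O, hO, h1O, hO1⟩ := exists_isOpen_siegelCharLoc_eq_one L e dV hdV dW hdW v χ s
  refine ⟨(fun p : localPi L (IsCMField.complexConj L) (n + n) (hermD L e dV hdV dW hdW) v => p₀⁻¹ * p) ⁻¹' O, hO.preimage
      (continuous_const.mul continuous_id), by rw [Set.mem_preimage, inv_mul_cancel]; exact h1O,
    fun p hp hpΔ => ?_⟩
  have hq : siegelCharLoc L e dV hdV dW hdW v χ s (p₀⁻¹ * p) = 1 := hO1 _ hp (mul_mem (inv_mem hp₀) hpΔ)
  have hfac : p = p₀ * (p₀⁻¹ * p) := by rw [mul_inv_cancel_left]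
  calc siegelCharLoc L e dV hdV dW hdW v χ s p = siegelCharLoc L e dV hdV dW hdW v χ s (p₀ * (p₀⁻¹ * p)) := by rw [← hfac]
    _ = siegelCharLoc L e dV hdV dW hdW v χ s p₀ * siegelCharLoc L e dV hdV dW hdW v χ s (p₀⁻¹ * p) := siegelCharLoc_mul L e dV hdV dW hdW v χ s hp₀ (mul_mem (inv_mem hp₀) hpΔ)
    _ = siegelCharLoc L e dV hdV dW hdW v χ s p₀ := by rw [hq, mul_one]

end Summit.HodgeConjecture.HodgeConjecture.Cruxes.HLiu418.K2LiuSiegelCharLocLocallyConstant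

end
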